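import Summits.KontsevichZagierPeriods.KontsevichZagierPeriods.Theses.HeckeMultiplicityOne

/-!
# `MultiplicityOneAlgebra` (stmt-KontsevichZagierPeriods-4690, route HeckeMultiplicityOne)

The algebraic heart of the multiplicity-one certificate, proved unconditionally and in slightly
greater generality than the route item asks (any additive group `G` with a subgroup `R` in place of
`KZ.FormalRep ⊇ KZ.relations`).

**Statement.** Let `T_j` (`j ∈ J`, any index type) be integer `k × k` matrices with integer
"eigenvalues" `a_j`, and `Λ : ℤ^k →+ G` additive with `Λ(T_j m) − a_j Λ(m) ∈ R` for all `j, m`.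
If the joint row-eigenspace `{φ ∈ ℚ^k : φ T_j = a_j φ ∀ j}` has dimension `≤ 1` (any two of its
elements are `ℚ`-proportional), then any two `m, m' ∈ ℤ^k` have `ℤ`-commensurable images:
`(c, c') ≠ (0, 0)` with `c Λ(m) − c' Λ(m') ∈ R`.

**Proof** (`commensurable_of_eigenDual`). Let `W ⊆ ℚ^k` be the `ℚ`-span of the integer vectors
`(T_j − a_j) e_i`.
* (integrality, `span_induction`) every `x ∈ W` has a nonzero integer multiple `n x = y` with
  `y ∈ ℤ^k` and `Λ y ∈ R` (clear denominators; `Λ` kills each generator modulo `R`);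
* (duality) a linear functional `f` on `ℚ^k` vanishing on `W` has coordinate vector
  `(f e_i)_i` in the joint row-eigenspace;
* if no nontrivial integer combination `c m − c' m'` lay in `W`, then `m ∉ W` and
  `m' ∉ W + ℚ m`, so (`Submodule.exists_dual_map_eq_bot_of_notMem`) there are functionals `f`
  (killing `W`, `f m ≠ 0`) and `f'` (killing `W + ℚ m`, `f' m' ≠ 0`); both are joint
  row-eigenvectors, hence proportional, `u f = v f'`; evaluating at `m` forces `u = 0`, so `v ≠ 0`
  and `f' = 0`, contradicting `f' m' ≠ 0`.
No commutativity of the `T_j` and no finiteness of `J` is used; torsion in `G ⧸ R` is harmless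
because only commensurability is asserted.

References: the linear algebra behind [Mazur–Swinnerton-Dyer 1974, §2], [Manin 1972, §1],
[Cremona 1997, Ch. II] (eigen-functionals of the Hecke algebra into a torsion-free group).
-/

open Summit.KontsevichZagierPeriods.KontsevichZagierPeriods.Theses.HeckeMultiplicityOne

namespace Summit.KontsevichZagierPeriods.HeckeMultiplicityOne.MultiplicityOneAlgebra

/-- **Commensurability from multiplicity one** (general form of the route item
`MultiplicityOneAlgebra`). For integer matrices `T j` with integer "eigenvalues" `a j`, an additive
map `Λ : ℤ^k →+ G` that is `T`-equivariant modulo the subgroup `R`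
(`Λ (T j *ᵥ m) - a j • Λ m ∈ R`), and a joint rational row-eigenspace of dimension `≤ 1`
(any two row vectors `φ` with `φ ᵥ* T j = a j • φ` for all `j` are `ℚ`-proportional), any two
integer vectors `m, m'` have `ℤ`-commensurable images modulo `R`. -/
theorem commensurable_of_eigenDual {G : Type*} [AddCommGroup G] (R : AddSubgroup G)
    {k : ℕ} {J : Type*} (T : J → Matrix (Fin k) (Fin k) ℤ) (a : J → ℤ) (Λ : (Fin k → ℤ) →+ G)
    (hΛ : ∀ (j : J) (m : Fin k → ℤ), Λ ((T j).mulVec m) - a j • Λ m ∈ R)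
    (hdim : ∀ φ ψ : Fin k → ℚ,
      (∀ j, Matrix.vecMul φ ((T j).map (Int.cast : ℤ → ℚ)) = (a j : ℚ) • φ) →
      (∀ j, Matrix.vecMul ψ ((T j).map (Int.cast : ℤ → ℚ)) = (a j : ℚ) • ψ) →
      ∃ u v : ℚ, (u ≠ 0 ∨ v ≠ 0) ∧ u • φ = v • ψ)
    (m m' : Fin k → ℤ) :
    ∃ c c' : ℤ, (c ≠ 0 ∨ c' ≠ 0) ∧ c • Λ m - c' • Λ m' ∈ R := by
  -- the coefficient extension `ℤ^k → ℚ^k`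
  let ι : (Fin k → ℤ) →ₗ[ℤ] (Fin k → ℚ) :=
    { toFun := fun y i => (y i : ℚ)
      map_add' := fun y y' => by funext i; simp
      map_smul' := fun n y => by funext i; simp }
  have hι : ∀ y i, ι y i = (y i : ℚ) := fun _ _ => rfl
  have hιinj : Function.Injective ι := fun y y' h => funext fun i => by
    have hi := congr_fun h i
    rw [hι, hι] at hi
    exact_mod_cast hi
  -- the standard basis of `ℤ^k`, the generators `(T j - a j) e i`, and their `ℚ`-span `W`
  let e : Fin k → (Fin k → ℤ) := fun i => Pi.single i 1
  let g : J × Fin k → (Fin k → ℚ) := fun p => ι ((T p.1).mulVec (e p.2) - a p.1 • e p.2)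
  let W : Submodule ℚ (Fin k → ℚ) := Submodule.span ℚ (Set.range g)
  have hιe : ∀ l, ι (e l) = fun j => if l = j then (1 : ℚ) else 0 := fun l => by
    funext j
    by_cases h : l = j
    · subst h; simp [hι, e]
    · simp [hι, e, h]
  have hexp : ∀ (f : Module.Dual ℚ (Fin k → ℚ)) (x : Fin k → ℚ),
      f x = ∑ l, x l * f (ι (e l)) := fun f x => by
    rw [LinearMap.pi_apply_eq_sum_univ]
    exact Finset.sum_congr rfl fun l _ => by rw [hιe, smul_eq_mul]
  -- (A) integrality: every element of `W` has a nonzero integer multiple which is the image of an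
  -- integer vector killed by `Λ` modulo `R`
  have hA : ∀ x ∈ W, ∃ n : ℤ, n ≠ 0 ∧ ∃ y : Fin k → ℤ, ι y = n • x ∧ Λ y ∈ R := by
    intro x hx
    induction hx using Submodule.span_induction with
    | mem x hx =>
      obtain ⟨⟨j, i⟩, rfl⟩ := hx
      refine ⟨1, one_ne_zero, (T j).mulVec (e i) - a j • e i, ?_, ?_⟩
      · rw [one_smul]
      · rw [map_sub, map_zsmul]
        exact hΛ j (e i)
    | zero =>
      exact ⟨1, one_ne_zero, 0, by rw [map_zero, smul_zero], by rw [map_zero]; exact R.zero_mem⟩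
    | add x x' _ _ hx hx' =>
      obtain ⟨n, hn, y, hy, hyR⟩ := hx
      obtain ⟨n', hn', y', hy', hyR'⟩ := hx'
      refine ⟨n * n', mul_ne_zero hn hn', n' • y + n • y', ?_, ?_⟩
      · rw [map_add, map_zsmul, map_zsmul, hy, hy', smul_add, smul_smul, smul_smul, mul_comm n' n]
      · rw [map_add, map_zsmul, map_zsmul]
        exact R.add_mem (R.zsmul_mem hyR _) (R.zsmul_mem hyR' _)
    | smul q x _ hx =>
      obtain ⟨n, hn, y, hy, hyR⟩ := hx
      refine ⟨n * q.den, mul_ne_zero hn (by exact_mod_cast q.den_ne_zero), q.num • y, ?_, ?_⟩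
      · rw [map_zsmul, hy, smul_smul, ← Int.cast_smul_eq_zsmul ℚ, ← Int.cast_smul_eq_zsmul ℚ (n * _),
          smul_smul]
        congr 1
        push_cast
        rw [mul_assoc, Rat.den_mul_eq_num, mul_comm]
      · rw [map_zsmul]
        exact R.zsmul_mem hyR _
  -- (B) duality: a functional vanishing on `W` has its coordinate vector in the joint row-eigenspace
  have hB : ∀ f : Module.Dual ℚ (Fin k → ℚ), (∀ x ∈ W, f x = 0) → ∀ j,
      Matrix.vecMul (fun i => f (ι (e i))) ((T j).map (Int.cast : ℤ → ℚ)) =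
        (a j : ℚ) • (fun i => f (ι (e i))) := by
    intro f hf j
    funext i
    have h0 : f (ι ((T j).mulVec (e i) - a j • e i)) = 0 :=
      hf _ (Submodule.subset_span ⟨(j, i), rfl⟩)
    have h1 : f (ι ((T j).mulVec (e i))) = (a j : ℚ) * f (ι (e i)) := by
      rw [map_sub, map_zsmul, map_sub, map_zsmul, zsmul_eq_mul, sub_eq_zero] at h0
      exact h0
    have h2 : ∀ l, ι ((T j).mulVec (e i)) l = (T j l i : ℚ) := fun l => by
      simp [hι, e]
    rw [Pi.smul_apply, smul_eq_mul, ← h1, hexp f]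
    simp only [Matrix.vecMul, dotProduct, Matrix.map_apply, h2]
    exact Finset.sum_congr rfl fun l _ => mul_comm _ _
  -- (D) it suffices to find a nontrivial integer combination of `m, m'` inside `W`
  suffices h : ∃ c c' : ℤ, (c ≠ 0 ∨ c' ≠ 0) ∧ ι (c • m - c' • m') ∈ W by
    obtain ⟨c, c', hcc', hmem⟩ := h
    obtain ⟨n, hn, y, hy, hyR⟩ := hA _ hmem
    rw [← map_zsmul] at hy
    have hy' := hιinj hy
    subst hy'
    refine ⟨n * c, n * c', ?_, ?_⟩
    · rcases hcc' with h | h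
      · exact Or.inl (mul_ne_zero hn h)
      · exact Or.inr (mul_ne_zero hn h)
    · have : Λ (n • (c • m - c' • m')) = (n * c) • Λ m - (n * c') • Λ m' := by
        rw [map_zsmul, map_sub, map_zsmul, map_zsmul, smul_sub, smul_smul, smul_smul]
      rw [← this]
      exact hyR
  -- (C) separation by functionals, contradicting multiplicity one
  by_contra H
  push Not at H
  have hm : ι m ∉ W := by simpa using H 1 0 (Or.inl one_ne_zero)
  have hm' : ι m' ∉ W ⊔ Submodule.span ℚ {ι m} := by
    intro h
    obtain ⟨w, hw, z, hz, hwz⟩ := Submodule.mem_sup.mp h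
    obtain ⟨q, rfl⟩ := Submodule.mem_span_singleton.mp hz
    refine H q.num q.den (Or.inr (by exact_mod_cast q.den_ne_zero)) ?_
    have : ι (q.num • m - (q.den : ℤ) • m') = -((q.den : ℚ) • w) := by
      rw [map_sub, map_zsmul, map_zsmul, ← hwz, smul_add, ← Int.cast_smul_eq_zsmul ℚ q.num,
        ← Int.cast_smul_eq_zsmul ℚ (q.den : ℤ), ← Int.cast_smul_eq_zsmul ℚ (q.den : ℤ), smul_smul,
        Int.cast_natCast, Rat.den_mul_eq_num]
      abel
    rw [this]
    exact W.neg_mem (W.smul_mem _ hw)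
  obtain ⟨f, hfm, hfW⟩ := Submodule.exists_dual_map_eq_bot_of_notMem hm inferInstance
  obtain ⟨f', hf'm', hf'W⟩ := Submodule.exists_dual_map_eq_bot_of_notMem hm' inferInstance
  have hf0 : ∀ x ∈ W, f x = 0 := fun x hx => by
    have h := Submodule.mem_map_of_mem (f := f) hx
    rwa [hfW, Submodule.mem_bot] at h
  have hf'0 : ∀ x ∈ W ⊔ Submodule.span ℚ {ι m}, f' x = 0 := fun x hx => by
    have h := Submodule.mem_map_of_mem (f := f') hx
    rwa [hf'W, Submodule.mem_bot] at h
  obtain ⟨u, v, huv, heq⟩ :=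
    hdim _ _ (hB f hf0) (hB f' fun x hx => hf'0 x (Submodule.mem_sup_left hx))
  have hff' : ∀ x, u * f x = v * f' x := fun x => by
    rw [hexp f x, hexp f' x, Finset.mul_sum, Finset.mul_sum]
    refine Finset.sum_congr rfl fun l _ => ?_
    have hl := congr_fun heq l
    simp only [Pi.smul_apply, smul_eq_mul] at hl
    rw [mul_left_comm, hl, mul_left_comm]
  have hu : u = 0 := by
    have h := hff' (ι m)
    rw [hf'0 _ (Submodule.mem_sup_right (Submodule.mem_span_singleton_self _)), mul_zero] at h
    exact (mul_eq_zero.mp h).resolve_right hfm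
  have hv : v ≠ 0 := huv.resolve_left (fun h => h hu)
  have h := hff' (ι m')
  rw [hu, zero_mul] at h
  exact hf'm' ((mul_eq_zero.mp h.symm).resolve_left hv)

/-- **Route item `MultiplicityOneAlgebra`** (stmt-KontsevichZagierPeriods-4690, route
`HeckeMultiplicityOne`): the certificate's algebraic heart over the coefficient group
`KZ.FormalRep ⧸ KZ.relations` — a Hecke-equivariant additive `Λ : ℤ^k →+ FormalRep` sends any two
integer vectors to `ℤ`-commensurable classes as soon as the joint rational row-eigenspace has
dimension `≤ 1` (multiplicity one). Immediate from `commensurable_of_eigenDual`. -/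
theorem multiplicityOneAlgebra_proof : MultiplicityOneAlgebra := by
  unfold MultiplicityOneAlgebra
  intro k J T a Λ hΛ hdim m m'
  exact commensurable_of_eigenDual _ T a Λ hΛ hdim m m'

end Summit.KontsevichZagierPeriods.HeckeMultiplicityOne.MultiplicityOneAlgebra
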